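import Literature.Analysis.FluidPDE.GKPCriticalElements
import Literature.Analysis.FunctionSpaces.LittlewoodPaleyBernsteinProofs
import HarnessLib

/-!
# GKP blow-up of critical Besov norms: the reduction to the four GKP statements

`Literature.Analysis.FluidPDE.GKPCriticalElements` proves
`Literature.Analysis.FluidPDE.gkp_besov_blowup_of_criticalElements`: Gallagher–Koch–Planchon's Theorem 1
(`Literature.Analysis.FluidPDE.gkp_besov_blowup`, Comm. Math. Phys. 343 (2016)) follows from the Besov embedding
`Literature.Analysis.FunctionSpaces.besov_embedding` (Bahouri–Chemin–Danchin 2011, Prop. 2.20) and the four statements of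
GKP §2.1 — three vendored there as named facts (`gkp_regularity_persistence` = (1.6)+(1.9),
`gkp_exists_criticalElement` = Prop. 2.1, `gkp_criticalElement_tendsto_zero` = Prop. 2.2) and the
statement of Prop. 2.3 as an explicit hypothesis `h3` (in the tree's rendering: a Besov mild
solution of the class `(s_p, p, p)` on `[0, T)` with bounded critical norm and `U t → 0` in `𝓢'`
as `t → T⁻` is not maximal; formerly the named fact `gkp_rigidity`, see the review note below).
The Besov embedding is now a theorem
(`Literature.Analysis.FunctionSpaces.besov_embedding_holds`, `LittlewoodPaleyBernsteinProofs.lean`, Bernstein's inequality on the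
dyadic blocks), so the reduction needs only the four GKP statements:
`Literature.Analysis.FluidPDE.gkp_besov_blowup_of_gkp`.

Conversely — and this is the logical shape of GKP's argument by contradiction — **Theorem 1
implies each of the three propositions of §2.1 as vendored**: Props. 2.1 and 2.2 are stated under
"`A_c < ∞`" (GKP: "in the case that `A_c < ∞` (i.e. Theorem 1 is false)", §2.1, p. 6 of
arXiv:1407.4156), and Theorem 1 for the class `(s_p, p, p)` gives `A_c = ∞`
(`gkp_besov_blowup.criticalBesovThreshold_eq_top`, from `criticalBesovThreshold_eq_top_of_biSup_eq_top`
and the `sup` form `gkp_besov_blowup.biSup_eq_top`), so that `𝒟_c = ∅`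
(`gkp_besov_blowup.not_isCriticalElement`); Prop. 2.3 (bounded critical norm on `[0, T)` ⟹ `T`
is not maximal) is the continuation form `gkp_besov_blowup.not_isMaximalBesovMildSolution_of_biSup_lt_top`
of Theorem 1, its `𝓢'`-convergence hypothesis being unnecessary a posteriori. Hence
`gkp_exists_criticalElement_of_gkp_besov_blowup`, `gkp_criticalElement_tendsto_zero_of_gkp_besov_blowup`,
`gkp_rigidity_of_gkp_besov_blowup`, the equivalence `gkp_besov_blowup_iff_gkp` (given (1.9)), and,
through `gkp_besov_blowup_of_albritton` (Albritton 2018, Thm. 1.1 ⟹ GKP Thm. 1), Props. 2.1 and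
2.2 from `albritton_besov_blowup`. Consequence for the bookkeeping of named facts: a discharge of
`gkp_besov_blowup` (or of `albritton_besov_blowup`) discharges the §2.1 facts by the one-liners
below; they carry no content beyond Theorem 1 and should not be attacked separately (their printed
proofs, §§2.3–2.5, rest on the profile decompositions Thms. 2–3, Prop. 2.6 and Prop. 2.8, a theory
absent from Mathlib and from this tree).

**Review of the decomposition (2026-08-15, D-0026).** Accordingly the named fact `gkp_rigidity`
(Prop. 2.3 in the tree's rendering) was **retired and merged back into the proof obligation of
`gkp_besov_blowup`**: it was mis-stated (next paragraph), it is Step 3 of the printed proof *by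
contradiction* of Thm. 1, its own proof (§2.5) is a theory (Prop. 2.8 = the iteration of §§4–5 in
the path spaces, ε-regularity, backward uniqueness, unique continuation), and it is a **corollary of
the parent** over one and the same class — `gkp_rigidity_of_gkp_besov_blowup` below, which now
concludes the *statement* of Prop. 2.3 (tree rendering, the hypothesis `h3` of
`gkp_besov_blowup_of_gkp`, verbatim the body of the former def); over GKP's class likewise
`gkp_rigidity_pathSpace_of_blowup_pathSpace` (`GKPCriticalElements.lean`). The dependency records
through Props. 2.1–2.3 in `NSCriticalClosureBesov*.lean` and `gkp_rigidity_of_albritton` here were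
dropped with it (one-line compositions).

**Verdicts of 2026-08-15 (read first).** The tree-class renderings
`gkp_regularity_persistence`, `gkp_exists_criticalElement`, `gkp_criticalElement_tendsto_zero` are
**deprecated as mis-stated** in `GKPCriticalElements.lean` (as was `gkp_rigidity` before its
retirement, and as are `gkp_besov_blowup` / `albritton_besov_blowup` in `CriticalRegularity.lean`):
in print
(arXiv:1407.4156, pp. 4, 6, 9) `NS(u₀)`, `T*(u₀)`, `A_c` and `𝒟_c` live in
Gallagher–Koch–Planchon's path-space class `𝓛^{1:∞}_p[T < T*]` (`IsGKPSolutionOn`,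
`IsMaximalGKPSolution`, `gkpCriticalThreshold`, `IsGKPCriticalElement` there), whereas the
renderings quantify over the tree's class `IsBesovMildSolutionOn` / `IsMaximalBesovMildSolution` /
`criticalBesovThreshold`, which is not a published uniqueness class; each rendering is its printed
statement plus the unprinted identification of the two classes
(`gkp_regularity_persistence_of_identification`, `gkp_exists_criticalElement_of_identification`,
`gkp_criticalElement_tendsto_zero_of_identification`; unfolded audits
`GKPRegularityPersistence.lean`, `GKPCriticalElementsPathSpace.lean`,
`GKPCompactnessPathSpace.lean`, `GKPRigidityProofs.lean` (`gkp_rigidity_of_pathSpace`, Prop. 2.3),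
and `CriticalRegularityPathSpace.lean` for Thm. 1). The reductions of this file are statements
*about* those renderings (and about `gkp_besov_blowup`, itself read over the tree's class) and
remain correct and in use (`GKPRigidityProofs.lean`, `NSCriticalClosureBesov*.lean`); they are kept
verbatim, with the deprecation linter silenced declaration by declaration. In particular the observation below —
given Theorem 1 *in the tree's rendering*, the three propositions *in the tree's rendering* hold
vacuously — is a statement inside the tree's class and says nothing about the printed
propositions over GKP's class.

Also proved (the elementary bookkeeping of GKP §2.3, "existence of a critical element", around
the definitions of `A_c` and `𝒟_c`): `criticalBesovThreshold_eq_top_iff_biSup` (`A_c = ∞` iff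
Theorem 1 in `sup` form on the diagonal class), `isCriticalElement_iff` /
`IsCriticalElement.of_biSup_le` (membership in `𝒟_c` needs only `sup ≤ A_c`, the reverse
inequality being automatic for a blowing-up solution — the closing step of §2.3),
`exists_isMaximal_biSup_lt` (above `A_c` there are blowing-up solutions with `sup < B`) and
`exists_minimizingSeq_criticalBesovThreshold` (§2.3, first step: "a sequence `u_{0,n}` … such
that `T*(u_{0,n}) < ∞` … `A_c ≤ A_n` and `A_n → A_c`"). The remaining steps of §2.3 (profile
decomposition of the minimizing sequence, Thm. 3, and Prop. 2.6) are the theory behind the named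
fact `gkp_exists_criticalElement` and are not formalised.

## References

* I. Gallagher, G. S. Koch, F. Planchon, *Blow-up of critical Besov norms at a potential
  Navier–Stokes singularity*, Comm. Math. Phys. 343 (2016), 39–82, Thm. 1 and §2.1 ("Theorem 1
  is an immediate corollary of the next three statements"). [cite: GKP2016, Thm. 1 and §2.1]
* H. Bahouri, J.-Y. Chemin, R. Danchin, *Fourier Analysis and Nonlinear Partial Differential
  Equations* (2011), Prop. 2.20. [cite: BahouriCheminDanchin2011, Prop. 2.20]
* D. Albritton, *Blow-up criteria for the Navier–Stokes equations in non-endpoint critical Besov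
  spaces*, Anal. PDE 11 (2018), 1415–1456, Thm. 1.1 (the `lim` form of GKP's Thm. 1; named fact
  `albritton_besov_blowup` of `CriticalRegularity.lean`). [cite: Albritton2018, Thm. 1.1]
-/

noncomputable section

open MeasureTheory TemperedDistribution Set Function Filter
open _root_.Topology
open scoped SchwartzMap ENNReal NNReal

namespace Literature.Analysis.FluidPDE

-- `linter.deprecated` is switched off for the next declaration only: it is a conditional
-- reduction over the tree's class naming the deprecated (mis-stated, 2026-08-15) renderings
-- `gkp_besov_blowup` / `albritton_besov_blowup` of `CriticalRegularity.lean` and/or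
-- `gkp_regularity_persistence` / `gkp_exists_criticalElement` / `gkp_criticalElement_tendsto_zero`
-- of `GKPCriticalElements.lean`; kept unchanged for its users (see the module docstring).
set_option linter.deprecated false in
/-- **GKP Theorem 1 from GKP §2.1** (Gallagher–Koch–Planchon 2016, Thm. 1, "an immediate
corollary of" Props. 2.1–2.3 given (1.6), (1.9) and the embedding (1.1)): the blow-up of the
critical Besov norms `gkp_besov_blowup` follows from the four GKP statements alone —
`gkp_regularity_persistence`, `gkp_exists_criticalElement`, `gkp_criticalElement_tendsto_zero` and
the statement `h3` of Prop. 2.3 (rigidity) in the tree's rendering: *for GKP exponents `p` and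
`ν > 0`, a Besov mild solution of the class `(s_p, p, p)` on `[0, T)`, `0 < T`, with
`sup_{[0,T)} ‖U t‖_{Ḃ^{s_p}_{p,p}} < ∞` and `U t → 0` in `𝓢'` as `t → T⁻` is not maximal with
lifespan `T`* (formerly the named fact `gkp_rigidity`, merged back into the proof obligation of
`gkp_besov_blowup`: it is its corollary `gkp_rigidity_of_gkp_besov_blowup`) — the Besov embedding
hypothesis of `gkp_besov_blowup_of_criticalElements` being discharged by
`Literature.Analysis.FunctionSpaces.besov_embedding_holds` (BCD Prop. 2.20, proved in
`LittlewoodPaleyBernsteinProofs.lean`). [cite: GKP2016, Thm. 1 and §2.1] -/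
theorem gkp_besov_blowup_of_gkp (h0 : gkp_regularity_persistence) (h1 : gkp_exists_criticalElement)
    (h2 : gkp_criticalElement_tendsto_zero)
    (h3 : ∀ {ν : ℝ}, 0 < ν → ∀ {p : ℝ≥0∞} [Fact (1 ≤ p)], IsGKPExponent p → ∀ {T : ℝ}, 0 < T →
      ∀ {u : ℝ → EuclideanSpace ℝ (Fin 3) → EuclideanSpace ℝ (Fin 3)}
        {U : ℝ → 𝓢'(EuclideanSpace ℝ (Fin 3), EuclideanSpace ℂ (Fin 3))},
      IsBesovMildSolutionOn (-1 + 3 / p.toReal) p p T ν u U →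
      ⨆ t ∈ Ico 0 T, FunctionSpaces.eHomBesovNorm (-1 + 3 / p.toReal) p p (U t) < ∞ →
      Tendsto U (𝓝[<] T) (𝓝 0) →
      ¬ IsMaximalBesovMildSolution (-1 + 3 / p.toReal) p p T ν u U) :
    gkp_besov_blowup :=
  gkp_besov_blowup_of_criticalElements FunctionSpaces.besov_embedding_holds h0 h1 h2 h3

/-! ## Theorem 1 implies Propositions 2.1–2.3 (the contradiction closes up) -/

section Converse

open MeasureTheory TemperedDistribution Set Function Filter Topology
open scoped SchwartzMap ENNReal NNReal

-- `linter.deprecated` is switched off for the next declaration only: it names the deprecated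
-- (mis-stated, 2026-08-15) tree-class rendering(s) of GKP Thm. 1 (`gkp_besov_blowup`,
-- `CriticalRegularity.lean`), kept unchanged for their users until the faithful path-space forms
-- are vendored (see those files).
set_option linter.deprecated false in
/-- **Theorem 1 ⟹ `A_c = ∞`** (GKP 2016, §2.1, p. 6: "in the case that `A_c < ∞` (i.e.
Theorem 1 is false)"): if the critical norm of every maximal Besov mild solution of the class
`(s_p, p, q)`, `3 < p, q < ∞`, with finite lifespan blows up (`gkp_besov_blowup`, used on the
diagonal `q = p` in its `sup` form `gkp_besov_blowup.biSup_eq_top`), then every finite bound is a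
globality bound and GKP's threshold `criticalBesovThreshold ν p` is `∞`
(`criticalBesovThreshold_eq_top_of_biSup_eq_top`). [cite: GKP2016, §2.1] -/
theorem gkp_besov_blowup.criticalBesovThreshold_eq_top (h : gkp_besov_blowup) {ν : ℝ}
    (hν : 0 < ν) {p : ℝ≥0∞} [Fact (1 ≤ p)] (hp₃ : 3 < p) (hp : p < ∞) :
    criticalBesovThreshold ν p = ∞ :=
  criticalBesovThreshold_eq_top_of_biSup_eq_top fun _ _ _ hT hmax =>
    h.biSup_eq_top hν hp₃ hp hp₃ hp hT hmax

-- `linter.deprecated` is switched off for the next declaration only: it names the deprecated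
-- (mis-stated, 2026-08-15) tree-class rendering(s) of GKP Thm. 1 (`gkp_besov_blowup`,
-- `CriticalRegularity.lean`), kept unchanged for their users until the faithful path-space forms
-- are vendored (see those files).
set_option linter.deprecated false in
/-- **Theorem 1 ⟹ `𝒟_c = ∅`** (GKP 2016, §2.1: the set `𝒟_c` of critical elements is only
introduced "in the case that `A_c < ∞`"): under `gkp_besov_blowup` there is no critical element
in any class `(s_p, p, p)`, `3 < p < ∞`, since a critical element has `A_c < ∞`
(`IsCriticalElement.threshold_lt_top`) while Theorem 1 gives `A_c = ∞`. [cite: GKP2016, §2.1] -/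
theorem gkp_besov_blowup.not_isCriticalElement (h : gkp_besov_blowup) {ν : ℝ} (hν : 0 < ν)
    {p : ℝ≥0∞} [Fact (1 ≤ p)] (hp₃ : 3 < p) (hp : p < ∞) {T : ℝ}
    {u : ℝ → EuclideanSpace ℝ (Fin 3) → EuclideanSpace ℝ (Fin 3)}
    {U : ℝ → 𝓢'(EuclideanSpace ℝ (Fin 3), EuclideanSpace ℂ (Fin 3))} :
    ¬ IsCriticalElement ν p T u U :=
  fun hc => hc.threshold_lt_top.ne (h.criticalBesovThreshold_eq_top hν hp₃ hp)

-- `linter.deprecated` is switched off for the next declaration only: it is a conditional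
-- reduction over the tree's class naming the deprecated (mis-stated, 2026-08-15) renderings
-- `gkp_besov_blowup` / `albritton_besov_blowup` of `CriticalRegularity.lean` and/or
-- `gkp_regularity_persistence` / `gkp_exists_criticalElement` / `gkp_criticalElement_tendsto_zero`
-- of `GKPCriticalElements.lean`; kept unchanged for its users (see the module docstring).
set_option linter.deprecated false in
/-- **Theorem 1 ⟹ Proposition 2.1** (GKP 2016, §2.1, Prop. 2.1: "if `A_c < ∞`, then `𝒟_c` is
non empty"): a posteriori the hypothesis `A_c < ∞` is false for every GKP exponent
(`gkp_besov_blowup.criticalBesovThreshold_eq_top`), so the vendored statement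
`gkp_exists_criticalElement` follows from `gkp_besov_blowup`. [cite: GKP2016, Prop. 2.1 and §2.1] -/
theorem gkp_exists_criticalElement_of_gkp_besov_blowup (h : gkp_besov_blowup) :
    gkp_exists_criticalElement := by
  intro ν hν p _ hp hA
  exact absurd (h.criticalBesovThreshold_eq_top hν hp.three_lt hp.lt_top) hA.ne

-- `linter.deprecated` is switched off for the next declaration only: it is a conditional
-- reduction over the tree's class naming the deprecated (mis-stated, 2026-08-15) renderings
-- `gkp_besov_blowup` / `albritton_besov_blowup` of `CriticalRegularity.lean` and/or
-- `gkp_regularity_persistence` / `gkp_exists_criticalElement` / `gkp_criticalElement_tendsto_zero`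
-- of `GKPCriticalElements.lean`; kept unchanged for its users (see the module docstring).
set_option linter.deprecated false in
/-- **Theorem 1 ⟹ Proposition 2.2** (GKP 2016, §2.1, Prop. 2.2: "if `A_c < ∞`, then any `u₀`
in `𝒟_c` satisfies `NS(u₀)(t) → 0` in `𝓢'` as `t ↗ T*(u₀)`"): a posteriori there are no
critical elements (`gkp_besov_blowup.not_isCriticalElement`), so the vendored statement
`gkp_criticalElement_tendsto_zero` follows from `gkp_besov_blowup`. (GKP's direct proof, §2.4,
uses the profile decomposition Thm. 3 and Prop. 2.6 instead.) [cite: GKP2016, Prop. 2.2 and §2.1] -/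
theorem gkp_criticalElement_tendsto_zero_of_gkp_besov_blowup (h : gkp_besov_blowup) :
    gkp_criticalElement_tendsto_zero := by
  intro ν hν p _ hp T u U hc
  exact absurd hc (h.not_isCriticalElement hν hp.three_lt hp.lt_top)

-- `linter.deprecated` is switched off for the next declaration only: it is a conditional
-- reduction over the tree's class naming the deprecated (mis-stated, 2026-08-15) renderings
-- `gkp_besov_blowup` / `albritton_besov_blowup` of `CriticalRegularity.lean` and/or
-- `gkp_regularity_persistence` / `gkp_exists_criticalElement` / `gkp_criticalElement_tendsto_zero`
-- of `GKPCriticalElements.lean`; kept unchanged for its users (see the module docstring).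
set_option linter.deprecated false in
/-- **Theorem 1 ⟹ Proposition 2.3 — the child is a corollary of the parent** (GKP 2016, §2.1,
Prop. 2.3: bounded critical norm on `[0, T*)` and `NS(u₀)(t) → 0` in `𝓢'` force `T* = ∞`): the
continuation form of Theorem 1 (`gkp_besov_blowup.not_isMaximalBesovMildSolution_of_biSup_lt_top`:
a bounded critical norm on `[0, T)` means `T` is not the maximal time) gives the statement of
Prop. 2.3 in the tree's rendering — verbatim the body of the former named fact `gkp_rigidity`
(merged back into the proof obligation of `gkp_besov_blowup` on review of the decomposition,
2026-08-15, on the strength of this theorem) and the hypothesis `h3` of `gkp_besov_blowup_of_gkp` —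
without using its `𝓢'`-convergence hypothesis. (GKP's direct proof, §2.5, uses Prop. 2.8,
`ε`-regularity, backward uniqueness and unique continuation instead.)
[cite: GKP2016, Prop. 2.3 and §2.1] -/
theorem gkp_rigidity_of_gkp_besov_blowup (h : gkp_besov_blowup) :
    ∀ {ν : ℝ}, 0 < ν → ∀ {p : ℝ≥0∞} [Fact (1 ≤ p)], IsGKPExponent p → ∀ {T : ℝ}, 0 < T →
      ∀ {u : ℝ → EuclideanSpace ℝ (Fin 3) → EuclideanSpace ℝ (Fin 3)}
        {U : ℝ → 𝓢'(EuclideanSpace ℝ (Fin 3), EuclideanSpace ℂ (Fin 3))},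
      IsBesovMildSolutionOn (-1 + 3 / p.toReal) p p T ν u U →
      ⨆ t ∈ Ico 0 T, FunctionSpaces.eHomBesovNorm (-1 + 3 / p.toReal) p p (U t) < ∞ →
      Tendsto U (𝓝[<] T) (𝓝 0) →
      ¬ IsMaximalBesovMildSolution (-1 + 3 / p.toReal) p p T ν u U := by
  intro ν hν p _ hp T hT u U _ hsup _
  exact h.not_isMaximalBesovMildSolution_of_biSup_lt_top hν hp.three_lt hp.lt_top hp.three_lt
    hp.lt_top hT hsup

-- `linter.deprecated` is switched off for the next declaration only: it is a conditional
-- reduction over the tree's class naming the deprecated (mis-stated, 2026-08-15) renderings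
-- `gkp_besov_blowup` / `albritton_besov_blowup` of `CriticalRegularity.lean` and/or
-- `gkp_regularity_persistence` / `gkp_exists_criticalElement` / `gkp_criticalElement_tendsto_zero`
-- of `GKPCriticalElements.lean`; kept unchanged for its users (see the module docstring).
set_option linter.deprecated false in
/-- **GKP §2.1, both ways.** Given the persistence statement (1.9) (`gkp_regularity_persistence`),
Theorem 1 (`gkp_besov_blowup`) is *equivalent* to the conjunction of Propositions 2.1, 2.2 (as
vendored) and 2.3 (its statement in the tree's rendering, the `h3` of `gkp_besov_blowup_of_gkp`):
"⟸" is the printed reduction (`gkp_besov_blowup_of_gkp`: "Theorem 1 is an immediate corollary of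
the next three statements"), "⟹" is the closing-up of the argument by contradiction (the three
propositions concern the case `A_c < ∞`, which Theorem 1 rules out). [cite: GKP2016, §2.1] -/
theorem gkp_besov_blowup_iff_gkp (h0 : gkp_regularity_persistence) :
    gkp_besov_blowup ↔
      gkp_exists_criticalElement ∧ gkp_criticalElement_tendsto_zero ∧
      ∀ {ν : ℝ}, 0 < ν → ∀ {p : ℝ≥0∞} [Fact (1 ≤ p)], IsGKPExponent p → ∀ {T : ℝ}, 0 < T →
      ∀ {u : ℝ → EuclideanSpace ℝ (Fin 3) → EuclideanSpace ℝ (Fin 3)}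
        {U : ℝ → 𝓢'(EuclideanSpace ℝ (Fin 3), EuclideanSpace ℂ (Fin 3))},
      IsBesovMildSolutionOn (-1 + 3 / p.toReal) p p T ν u U →
      ⨆ t ∈ Ico 0 T, FunctionSpaces.eHomBesovNorm (-1 + 3 / p.toReal) p p (U t) < ∞ →
      Tendsto U (𝓝[<] T) (𝓝 0) →
      ¬ IsMaximalBesovMildSolution (-1 + 3 / p.toReal) p p T ν u U :=
  ⟨fun h => ⟨gkp_exists_criticalElement_of_gkp_besov_blowup h,
    gkp_criticalElement_tendsto_zero_of_gkp_besov_blowup h, gkp_rigidity_of_gkp_besov_blowup h⟩,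
    fun h => gkp_besov_blowup_of_gkp h0 h.1 h.2.1 h.2.2⟩

-- `linter.deprecated` is switched off for the next declaration only: it is a conditional
-- reduction over the tree's class naming the deprecated (mis-stated, 2026-08-15) renderings
-- `gkp_besov_blowup` / `albritton_besov_blowup` of `CriticalRegularity.lean` and/or
-- `gkp_regularity_persistence` / `gkp_exists_criticalElement` / `gkp_criticalElement_tendsto_zero`
-- of `GKPCriticalElements.lean`; kept unchanged for its users (see the module docstring).
set_option linter.deprecated false in
/-- **Albritton ⟹ Proposition 2.1**: Albritton's `lim` form of the blow-up
(`albritton_besov_blowup`, Albritton 2018, Thm. 1.1) implies GKP's Theorem 1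
(`gkp_besov_blowup_of_albritton`), hence the vendored Prop. 2.1. [cite: Albritton2018, Thm. 1.1] -/
theorem gkp_exists_criticalElement_of_albritton (h : albritton_besov_blowup) :
    gkp_exists_criticalElement :=
  gkp_exists_criticalElement_of_gkp_besov_blowup (gkp_besov_blowup_of_albritton h)

-- `linter.deprecated` is switched off for the next declaration only: it is a conditional
-- reduction over the tree's class naming the deprecated (mis-stated, 2026-08-15) renderings
-- `gkp_besov_blowup` / `albritton_besov_blowup` of `CriticalRegularity.lean` and/or
-- `gkp_regularity_persistence` / `gkp_exists_criticalElement` / `gkp_criticalElement_tendsto_zero`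
-- of `GKPCriticalElements.lean`; kept unchanged for its users (see the module docstring).
set_option linter.deprecated false in
/-- **Albritton ⟹ Proposition 2.2**: Albritton 2018, Thm. 1.1 implies GKP's Theorem 1
(`gkp_besov_blowup_of_albritton`), hence the vendored Prop. 2.2
(`gkp_criticalElement_tendsto_zero_of_gkp_besov_blowup`). [cite: Albritton2018, Thm. 1.1] -/
theorem gkp_criticalElement_tendsto_zero_of_albritton (h : albritton_besov_blowup) :
    gkp_criticalElement_tendsto_zero :=
  gkp_criticalElement_tendsto_zero_of_gkp_besov_blowup (gkp_besov_blowup_of_albritton h)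

end Converse

/-! ## Bookkeeping of §2.3: `A_c = ∞` versus Theorem 1, membership in `𝒟_c`, minimizing sequences -/

section MinimizingSequence

open MeasureTheory TemperedDistribution Set Function Filter Topology
open scoped SchwartzMap ENNReal NNReal

-- `linter.deprecated` is switched off for the next declaration only: it names the deprecated
-- (mis-stated, 2026-08-15) tree-class rendering(s) of GKP Thm. 1 (`gkp_besov_blowup`,
-- `CriticalRegularity.lean`), kept unchanged for their users until the faithful path-space forms
-- are vendored (see those files).
set_option linter.deprecated false in
/-- Synonym of `gkp_besov_blowup.criticalBesovThreshold_eq_top` (Theorem 1 ⟹ `A_c = ∞`;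
GKP 2016, §2.1). [cite: GKP2016, §2.1] -/
theorem criticalBesovThreshold_eq_top_of_gkp_besov_blowup (h : gkp_besov_blowup) {ν : ℝ}
    (hν : 0 < ν) {p : ℝ≥0∞} [Fact (1 ≤ p)] (hp₃ : 3 < p) (hp : p < ∞) :
    criticalBesovThreshold ν p = ∞ :=
  h.criticalBesovThreshold_eq_top hν hp₃ hp

/-- **`A_c = ∞` iff Theorem 1 (in `sup` form) holds for the class `(s_p, p, p)`** (GKP 2016,
§2.1: "in the case that `A_c < ∞` (i.e. Theorem 1 is false)"): "⟸" is
`criticalBesovThreshold_eq_top_of_biSup_eq_top`; "⟹" because every maximal solution with finite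
lifespan has `sup_{[0,T)} ‖U t‖ ≥ A_c` (`criticalBesovThreshold_le_biSup`). [cite: GKP2016, §2.1] -/
theorem criticalBesovThreshold_eq_top_iff_biSup {ν : ℝ} {p : ℝ≥0∞} [Fact (1 ≤ p)] :
    criticalBesovThreshold ν p = ∞ ↔
      ∀ ⦃T : ℝ⦄ ⦃u : ℝ → EuclideanSpace ℝ (Fin 3) → EuclideanSpace ℝ (Fin 3)⦄
        ⦃U : ℝ → 𝓢'(EuclideanSpace ℝ (Fin 3), EuclideanSpace ℂ (Fin 3))⦄, 0 < T →
        IsMaximalBesovMildSolution (-1 + 3 / p.toReal) p p T ν u U →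
          ⨆ t ∈ Ico 0 T, FunctionSpaces.eHomBesovNorm (-1 + 3 / p.toReal) p p (U t) = ∞ :=
  ⟨fun h _ _ _ hT hmax => eq_top_iff.2 (h ▸ criticalBesovThreshold_le_biSup hT hmax),
    fun h => criticalBesovThreshold_eq_top_of_biSup_eq_top h⟩

/-- **Membership in `𝒟_c` needs only `sup ≤ A_c`** (GKP 2016, §2.3, closing step: for a
solution with `T* < ∞`, "by definition of `A_c`" the supremum is `≥ A_c`
(`criticalBesovThreshold_le_biSup`), so `sup ≤ A_c < ∞` already gives `sup = A_c`).
[cite: GKP2016, §2.3] -/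
theorem IsCriticalElement.of_biSup_le {ν : ℝ} {p : ℝ≥0∞} [Fact (1 ≤ p)] {T : ℝ}
    {u : ℝ → EuclideanSpace ℝ (Fin 3) → EuclideanSpace ℝ (Fin 3)}
    {U : ℝ → 𝓢'(EuclideanSpace ℝ (Fin 3), EuclideanSpace ℂ (Fin 3))} (hT : 0 < T)
    (hmax : IsMaximalBesovMildSolution (-1 + 3 / p.toReal) p p T ν u U)
    (hle : ⨆ t ∈ Ico 0 T, FunctionSpaces.eHomBesovNorm (-1 + 3 / p.toReal) p p (U t) ≤
      criticalBesovThreshold ν p)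
    (hA : criticalBesovThreshold ν p < ∞) : IsCriticalElement ν p T u U where
  pos := hT
  isMaximal := hmax
  biSup_eq := le_antisymm hle (criticalBesovThreshold_le_biSup hT hmax)
  threshold_lt_top := hA

/-- **`𝒟_c` unfolded** (GKP 2016, §2.1, definition of `𝒟_c`): `(u, U)` is a critical element
iff `0 < T`, `(u, U)` is maximal in the class `(s_p, p, p)` with lifespan `T`,
`sup_{[0,T)} ‖U t‖ ≤ A_c` and `A_c < ∞` (the inequality `≥` is automatic,
`criticalBesovThreshold_le_biSup`). [cite: GKP2016, §2.1] -/
theorem isCriticalElement_iff {ν : ℝ} {p : ℝ≥0∞} [Fact (1 ≤ p)] {T : ℝ}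
    {u : ℝ → EuclideanSpace ℝ (Fin 3) → EuclideanSpace ℝ (Fin 3)}
    {U : ℝ → 𝓢'(EuclideanSpace ℝ (Fin 3), EuclideanSpace ℂ (Fin 3))} :
    IsCriticalElement ν p T u U ↔
      0 < T ∧ IsMaximalBesovMildSolution (-1 + 3 / p.toReal) p p T ν u U ∧
        ⨆ t ∈ Ico 0 T, FunctionSpaces.eHomBesovNorm (-1 + 3 / p.toReal) p p (U t) ≤
            criticalBesovThreshold ν p ∧
          criticalBesovThreshold ν p < ∞ :=
  ⟨fun h => ⟨h.pos, h.isMaximal, h.biSup_eq.le, h.threshold_lt_top⟩,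
    fun h => IsCriticalElement.of_biSup_le h.1 h.2.1 h.2.2.1 h.2.2.2⟩

/-- **Above `A_c` there are blowing-up solutions** (GKP 2016, §2.1/§2.3: `A_c` is the supremum
of the globality bounds, so any `B > A_c` fails to be one): if `A_c < B` there is a maximal Besov
mild solution of the class `(s_p, p, p)` with finite lifespan `0 < T` and
`A_c ≤ sup_{[0,T)} ‖U t‖ < B`. Indeed, pick `A_c < A < B`; if every such solution had `sup ≥ B`,
then `A` would be a globality bound, contradicting `A_c < A`. [cite: GKP2016, §2.3] -/
theorem exists_isMaximal_biSup_lt {ν : ℝ} {p : ℝ≥0∞} [Fact (1 ≤ p)] {B : ℝ≥0∞}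
    (hB : criticalBesovThreshold ν p < B) :
    ∃ (T : ℝ) (u : ℝ → EuclideanSpace ℝ (Fin 3) → EuclideanSpace ℝ (Fin 3))
      (U : ℝ → 𝓢'(EuclideanSpace ℝ (Fin 3), EuclideanSpace ℂ (Fin 3))),
      0 < T ∧ IsMaximalBesovMildSolution (-1 + 3 / p.toReal) p p T ν u U ∧
        criticalBesovThreshold ν p ≤
            ⨆ t ∈ Ico 0 T, FunctionSpaces.eHomBesovNorm (-1 + 3 / p.toReal) p p (U t) ∧
          ⨆ t ∈ Ico 0 T, FunctionSpaces.eHomBesovNorm (-1 + 3 / p.toReal) p p (U t) < B := by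
  obtain ⟨A, hAcA, hAB⟩ := exists_between hB
  by_contra hcon
  push Not at hcon
  have hA : IsGlobalityBound ν p A := fun T u U hT hmax =>
    hAB.trans_le (hcon T u U hT hmax (criticalBesovThreshold_le_biSup hT hmax))
  exact hAcA.not_ge (le_sSup hA)

/-- **Minimizing sequences for `A_c`** (GKP 2016, §2.3, first step of the proof of Prop. 2.1:
"let us consider a sequence `u_{0,n}`, bounded in the space `Ḃ^{s_p}_{p,p}`, such that its life
span satisfies `T*(u_{0,n}) < ∞` for each `n` and such that
`A_n := sup_{t ∈ [0,T*(u_{0,n}))} ‖NS(u_{0,n})(t)‖` satisfies `A_c ≤ A_n` and `A_n → A_c`"): if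
`A_c < ∞` there are maximal Besov mild solutions `(u n, U n)` with finite lifespans `0 < T n`
whose suprema `A_n` satisfy `A_c ≤ A_n` and `A_n → A_c` (take `A_n < A_c + (n+1)⁻¹` by
`exists_isMaximal_biSup_lt`). [cite: GKP2016, §2.3] -/
theorem exists_minimizingSeq_criticalBesovThreshold {ν : ℝ} {p : ℝ≥0∞} [Fact (1 ≤ p)]
    (hA : criticalBesovThreshold ν p < ∞) :
    ∃ (T : ℕ → ℝ) (u : ℕ → ℝ → EuclideanSpace ℝ (Fin 3) → EuclideanSpace ℝ (Fin 3))
      (U : ℕ → ℝ → 𝓢'(EuclideanSpace ℝ (Fin 3), EuclideanSpace ℂ (Fin 3))),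
      (∀ n, 0 < T n ∧ IsMaximalBesovMildSolution (-1 + 3 / p.toReal) p p (T n) ν (u n) (U n)) ∧
        (∀ n, criticalBesovThreshold ν p ≤
            ⨆ t ∈ Ico 0 (T n), FunctionSpaces.eHomBesovNorm (-1 + 3 / p.toReal) p p (U n t)) ∧
          Tendsto (fun n => ⨆ t ∈ Ico 0 (T n),
              FunctionSpaces.eHomBesovNorm (-1 + 3 / p.toReal) p p (U n t))
            atTop (𝓝 (criticalBesovThreshold ν p)) := by
  set Ac := criticalBesovThreshold ν p
  have hε : ∀ n : ℕ, Ac < Ac + ((n : ℝ≥0∞) + 1)⁻¹ := fun n =>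
    ENNReal.lt_add_right hA.ne (ENNReal.inv_ne_zero.2 (by simp))
  choose T u U hT hmax hge hlt using fun n => exists_isMaximal_biSup_lt (hε n)
  refine ⟨T, u, U, fun n => ⟨hT n, hmax n⟩, hge, ?_⟩
  have hupper : Tendsto (fun n : ℕ => Ac + ((n : ℝ≥0∞) + 1)⁻¹) atTop (𝓝 Ac) := by
    have h1 : Tendsto (fun n : ℕ => ((n : ℝ≥0∞) + 1)⁻¹) atTop (𝓝 0) := by
      have := ENNReal.tendsto_inv_nat_nhds_zero.comp (tendsto_add_atTop_nat 1)
      refine this.congr fun n => ?_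
      simp [Function.comp]
    simpa only [add_zero] using tendsto_const_nhds.add h1
  exact tendsto_of_tendsto_of_tendsto_of_le_of_le tendsto_const_nhds hupper hge
    fun n => (hlt n).le

end MinimizingSequence

end Literature.Analysis.FluidPDE
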